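import Mathlib
import Summits.ResolutionOfSingularities.ResolutionOfSingularities.Theorems.RadicialJungCleanModelsCleanLU3ArcPackage
import HarnessLib

/-!
# Route `RadicialJung`, crux `CleanModels` (stmt-15917), stub `stub_cleanLU3DefectNonDiscrete`, sub-line (C-div): preliminaries for the
# GENERAL divisorial coarsening (piece F1-prelim) — residual algebraicity from «every centre is a closed point»

Line `Sketch` rev 24 of crux stmt-ResolutionOfSingularities-15917; lead `res-B-lead-1` g4 (workfile `Lines/Sketch_Cdiv_assembly.lean` v2.1,
piece F1-prelim).  OURS; nothing here proves resolution in characteristic `p`.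

`exists_poly_unit_coeff_of_centres_isMaximal`: if every subring `T` with `A ⊆ T ⊆ O` has maximal centre (hypothesis `hzd` of the crux's
stubs) then every element of `O` satisfies a polynomial relation over `S = locAtCentre A O` with a unit coefficient modulo `𝔪_O` — the residue
field of `O` is algebraic over that of `S` (hypothesis `hres` of the tree's `exists_model_regular_of_lt_of_cjs`, Cossart–Piltant 2019 Prop. 4.10's
frame): for `y ∈ O` the centre of `O` on `A[y]` is maximal, so `A[y]/centre` is a field finitely generated over `k`, hence finite (Zariski's
lemma), and the minimal polynomial of the class of `y` is monic with value `< 1` at `y`.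
-/

noncomputable section

set_option linter.dupNamespace false -- mandated namespace of this single-conjunct summit

open IsLocalRing Polynomial
open Literature.AlgebraicGeometry.Resolution

namespace Summit.ResolutionOfSingularities.ResolutionOfSingularities.Theorems.RadicialJung.CleanModels

variable {K : Type} [Field K] {k : Type} [Field k] [Algebra k K]

/-- **Residual algebraicity from closed centres.**  See the module docstring. [folklore] -/
theorem exists_poly_unit_coeff_of_centres_isMaximal (O : ValuationSubring K) (A : Subalgebra k K) (hAO : A.toSubring ≤ O.toSubring)
    (hAfg : A.FG)
    (hzd : ∀ (T : Subring K) (hT : T ≤ O.toSubring), A.toSubring ≤ T → (subringCentre T O hT).IsMaximal)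
    (y : K) (hy : y ∈ O) :
    ∃ m : k[X], m.Monic ∧ O.valuation (aeval y m) < 1 := by
  classical
  -- the model `A[y]`
  obtain ⟨A', hA'eq, hAA', hA'fg⟩ := exists_subalgebra_closure A ({y} : Finset K)
  have hA'fg' : A'.FG := hA'fg hAfg
  have hA'O : A'.toSubring ≤ O.toSubring := by
    rw [hA'eq, Subring.closure_le]
    rintro z (hz | hz)
    · exact hAO hz
    · rw [Finset.coe_singleton, Set.mem_singleton_iff] at hz
      rw [hz]; exact hy
  have hyA' : y ∈ A' := by
    change y ∈ A'.toSubring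
    rw [hA'eq]; exact Subring.subset_closure (Or.inr (by simp))
  -- the centre is maximal: `F := A'/𝔫` is a field, finitely generated over `k`, hence finite
  set 𝔫 := subringCentre A'.toSubring O hA'O with h𝔫
  haveI h𝔫max : 𝔫.IsMaximal := hzd _ hA'O (fun z hz => hAA' hz)
  -- `𝔫` as an ideal of the `k`-algebra `A'`
  let 𝔫' : Ideal A' := 𝔫
  haveI : 𝔫'.IsMaximal := h𝔫max
  let F := A' ⧸ 𝔫'
  letI : Field F := Ideal.Quotient.field 𝔫'
  haveI : Algebra.FiniteType k A' := (Subalgebra.fg_iff_finiteType A').mp hA'fg'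
  haveI : Algebra.FiniteType k F :=
    Algebra.FiniteType.of_surjective (Ideal.Quotient.mkₐ k 𝔫') (Ideal.Quotient.mkₐ_surjective k 𝔫')
  haveI : Module.Finite k F := finite_of_finite_type_of_isJacobsonRing k F
  haveI : Algebra.IsIntegral k F := Algebra.IsIntegral.of_finite k F
  -- the minimal polynomial of the class of `y`
  let yb : F := Ideal.Quotient.mk 𝔫' ⟨y, hyA'⟩
  let m : k[X] := minpoly k yb
  have hm : m.Monic := minpoly.monic (Algebra.IsIntegral.isIntegral yb)
  refine ⟨m, hm, ?_⟩
  -- `aeval y m ∈ 𝔫`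
  have h1 : Ideal.Quotient.mk 𝔫' (aeval (⟨y, hyA'⟩ : A') m) = 0 := by
    rw [← Ideal.Quotient.mkₐ_eq_mk k, ← aeval_algHom_apply, Ideal.Quotient.mkₐ_eq_mk]
    exact minpoly.aeval k yb
  rw [Ideal.Quotient.eq_zero_iff_mem] at h1
  have h2 : (aeval (⟨y, hyA'⟩ : A') m : A') ∈ 𝔫 := h1
  rw [h𝔫, subringCentre_eq, Ideal.mem_comap] at h2
  have h3 := (O.valuation_lt_one_iff _).mp h2
  have h4 : ((aeval (⟨y, hyA'⟩ : A') m : A') : K) = aeval y m := by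
    rw [← Subalgebra.coe_val, ← aeval_algHom_apply]; rfl
  rw [← h4]
  exact h3

end Summit.ResolutionOfSingularities.ResolutionOfSingularities.Theorems.RadicialJung.CleanModels

end
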